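import Literature.MathematicalPhysics.KineticTheory.TaggedSphereFibreEnergy
import HarnessLib

/-!
# Pointwise relaxation of the Fourier fibres of the tagged linear Boltzmann equation
(Bodineau–Gallagher–Saint-Raymond, Invent. Math. 203 (2016) = arXiv:1305.3397v2, §6.1.3, the
convergence (6.3) mode by mode, locally uniformly in the velocity; a layer of the proof of the
hydrodynamic limit `Literature.MathematicalPhysics.KineticTheory.bgsr_hydrodynamicLimit` of
`TaggedSphereDiffusion`)

The energy estimate of `TaggedSphereFibreEnergy` controls the `k`-th Fourier coefficient
`ψ_k(t, ·)` of the solution of (1.3) in `L²(M_β dv)`: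
`∫ |ψ_k(t, v) - ρ̂⁰(k) e^{-λt/α}|² M_β dv ≤ C/α` on `[0, αT]`. This file upgrades it to a bound
*uniform on compact velocity sets*, which is what the weighted `L^∞` statement (6.3) requires:
for every `V`, `ε > 0` there is `α₀` with `|ψ_k(t, v) - ρ̂⁰(k) e^{-λt/α}| ≤ ε` for `α ≥ α₀`,
`t ∈ [0, αT]`, `|v| ≤ V` (`norm_fibreDiff_le_of_large`). The mechanism is one Duhamel iteration in
the velocity variable (the integrating-factor form of the fibred equation,
`TaggedSphereFourierFibre.kineticFibre_linearBoltzmannSeries_eq`): the difference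
`D = ψ_k - ρ̂⁰(k) e^{-λt/α}` satisfies
`D(t, v) = α ∫₀ᵗ e^{-(αa_β+iθ_k)(t-s)} (K D(s))(v) ds - ∫₀ᵗ e^{-(αa_β+iθ_k)(t-s)} (iθ_k - λ/α) ρ̂⁰(k) e^{-λs/α} ds`
(`fibreDiff_eq`), the second term is `O(1/α)` locally uniformly, and `K` maps
`L²(M_β)`-small bounded functions to locally small ones: splitting the Carleman integral at
`|u| = δ`, the near part is small by Grad's bound `M_β(v) k_β(v,u) ≤ G_β(u) √(M_β(v)M_β(v+u))`
(`∫_{|u|<δ} G_β → 0`), and the far part is controlled by `k_β(v,u)²/M_β(v+u) ≤ G_β(u)²/M_β(v)`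
and the `L²(M_β)` norm of `D(s)` (`norm_carlemanGainC_le_nearFar`).

## References

* T. Bodineau, I. Gallagher, L. Saint-Raymond, *The Brownian motion as the limit of a
  deterministic system of hard-spheres*, Invent. Math. 203 (2016) 493–553 = arXiv:1305.3397v2,
  §6.1.3 and (6.3).
* C. Cercignani, R. Illner, M. Pulvirenti, *The Mathematical Theory of Dilute Gases* (1994), §7.2
  (Grad's estimates for the hard-sphere gain kernel).
-/

noncomputable section

open MeasureTheory Metric Set Filter Topology ProbabilityTheory Complex
open scoped InnerProductSpace ENNReal NNReal Real

/-- As in `TaggedSphereFourierFibre`: the measure on `ℝ/ℤ` is the Haar probability measure.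
[folklore] -/
local instance fibrePointwiseMeasureSpace : MeasureSpace UnitAddCircle := ⟨AddCircle.haarAddCircle⟩

/-- The measure on `ℝ/ℤ` is a Haar measure. [folklore] -/
local instance fibrePointwiseIsAddHaarMeasure : Measure.IsAddHaarMeasure (volume : Measure UnitAddCircle) :=
  inferInstanceAs (Measure.IsAddHaarMeasure AddCircle.haarAddCircle)

/-- The measure on `ℝ/ℤ` is a probability measure. [folklore] -/
local instance fibrePointwiseIsProbabilityMeasure : IsProbabilityMeasure (volume : Measure UnitAddCircle) :=
  inferInstanceAs (IsProbabilityMeasure AddCircle.haarAddCircle)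

namespace Literature.MathematicalPhysics.KineticTheory

open Literature.Analysis.FunctionSpaces (maxwellianBeta maxwellianBeta_pos)
open TaggedSphereDiffusion (collisionFrequency)
open UnitAddTorus

variable {d : Type*} [Fintype d] {β α : ℝ}

local notation "𝔼" => EuclideanSpace ℝ d
local notation "𝕋" => UnitAddTorus d

/-! ## The Duhamel identity for `D = ψ_k - ρ̂⁰(k) e^{-λt/α}` -/

section Duhamel

open Literature.Analysis.FluidPDE Literature.Analysis.FunctionSpaces

variable {b : EuclideanSpace ℝ d → EuclideanSpace ℝ d} {ρ₀ : UnitAddTorus d → ℝ} {ϱ : ℝ} {k : d → ℤ}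

/-- The heat factor of the `k`-th mode in kinetic time, `ρ̂⁰(k) e^{-λt/α}` (constant in `v`). [folklore] -/
def heatFibre (β α : ℝ) (b : 𝔼 → 𝔼) (ρ₀ : 𝕋 → ℝ) (k : d → ℤ) (t : ℝ) : ℂ :=
  datumCoeff ρ₀ k * (Real.exp (-(heatRate β b k / α * t)) : ℂ)

/-- The difference `D(t, v) = ψ_k(t, v) - ρ̂⁰(k) e^{-λt/α}`. [folklore] -/
def fibreDiff (β α : ℝ) (b : 𝔼 → 𝔼) (ρ₀ : 𝕋 → ℝ) (k : d → ℤ) (t : ℝ) (v : 𝔼) : ℂ :=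
  seriesFibre β α ρ₀ k t v - heatFibre β α b ρ₀ k t

/-- **Variation of constants for the heat factor**: for every `c ∈ ℂ`,
`g e^{-μt} = e^{-ct} g + ∫₀ᵗ e^{-c(t-s)} (c - μ) g e^{-μs} ds` (FTC on `s ↦ e^{-c(t-s)} e^{-μs}`). [folklore] -/
theorem heatFactor_duhamel (g c : ℂ) (μ t : ℝ) :
    g * (Real.exp (-(μ * t)) : ℂ) = Complex.exp (-c * t) * g +
      ∫ s in (0 : ℝ)..t, Complex.exp (-c * (t - s)) * ((c - μ) * (g * (Real.exp (-(μ * s)) : ℂ))) := by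
  -- `F(s) = e^{-c(t-s)} g e^{-μ s}`, `F' = (c - μ) F`
  have hF : ∀ s : ℝ, HasDerivAt (fun s : ℝ => Complex.exp (-c * (t - s)) * (g * Complex.exp (-(μ : ℂ) * s)))
      (Complex.exp (-c * (t - s)) * ((c - μ) * (g * Complex.exp (-(μ : ℂ) * s)))) s := by
    intro s
    have h1 : HasDerivAt (fun s : ℝ => -c * ((t : ℂ) - s)) c s := by
      have h2 : HasDerivAt (fun s : ℝ => ((t : ℂ) - s)) (-1) s := by
        simpa using (Complex.ofRealCLM.hasDerivAt (x := s)).const_sub (t : ℂ)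
      simpa using h2.const_mul (-c)
    have h3 : HasDerivAt (fun s : ℝ => Complex.exp (-c * ((t : ℂ) - s))) (Complex.exp (-c * (t - s)) * c) s :=
      (Complex.hasDerivAt_exp _).comp s h1
    have h4 : HasDerivAt (fun s : ℝ => -(μ : ℂ) * s) (-(μ : ℂ)) s := by
      simpa using (Complex.ofRealCLM.hasDerivAt (x := s)).const_mul (-(μ : ℂ))
    have h5 : HasDerivAt (fun s : ℝ => g * Complex.exp (-(μ : ℂ) * s)) (g * (Complex.exp (-(μ : ℂ) * s) * -(μ : ℂ))) s :=
      ((Complex.hasDerivAt_exp _).comp s h4).const_mul g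
    have h6 := h3.mul h5
    have h7 : Complex.exp (-c * ((t : ℂ) - s)) * c * (g * Complex.exp (-(μ : ℂ) * s)) +
        Complex.exp (-c * ((t : ℂ) - s)) * (g * (Complex.exp (-(μ : ℂ) * s) * -(μ : ℂ))) =
        Complex.exp (-c * (t - s)) * ((c - μ) * (g * Complex.exp (-(μ : ℂ) * s))) := by ring
    rw [h7] at h6
    exact h6
  have hcont : Continuous fun s : ℝ => Complex.exp (-c * (t - s)) * ((c - μ) * (g * Complex.exp (-(μ : ℂ) * s))) := by
    fun_prop
  have hint := intervalIntegral.integral_eq_sub_of_hasDerivAt (a := 0) (b := t) (fun s _ => hF s) (hcont.intervalIntegrable 0 t)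
  have hcast : ∀ s : ℝ, (Real.exp (-(μ * s)) : ℂ) = Complex.exp (-(μ : ℂ) * s) := fun s => by
    rw [Complex.ofReal_exp]; congr 1; push_cast; ring
  simp_rw [hcast]
  rw [hint]
  simp only [sub_self, mul_zero, Complex.exp_zero, one_mul, Complex.ofReal_zero, sub_zero]
  ring

/-- `K` of the (constant in `v`) heat factor is `a_β` times it. [folklore] -/
theorem carlemanGainC_const (hd : 2 ≤ Fintype.card d) (hβ : 0 < β) (z : ℂ) (v : 𝔼) :
    carlemanGainC β (fun _ => z) v = (collisionFrequency β v : ℂ) * z := by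
  have h := carlemanGainC_const_mul β z (fun _ => (1 : ℂ)) v
  simp only [mul_one] at h
  rw [h, carlemanGainC_one hd hβ, mul_comm]

/-- `K D(s) = K ψ(s) - a_β ρ̂⁰ e^{-λs/α}`. [folklore] -/
theorem carlemanGainC_fibreDiff (h : LinearBoltzmannData (Torus.geometry d) β α (fun x _ => ρ₀ x) ϱ)
    (hd : 2 ≤ Fintype.card d) (k : d → ℤ) (s : ℝ) (v : 𝔼) :
    carlemanGainC β (fibreDiff β α b ρ₀ k s) v =
      carlemanGainC β (seriesFibre β α ρ₀ k s) v - (collisionFrequency β v : ℂ) * heatFibre β α b ρ₀ k s := by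
  have hβ := h.beta_pos
  have h1 : Integrable fun u => (carlemanKernel β v u : ℂ) * seriesFibre β α ρ₀ k s (v + u) :=
    integrable_carlemanKernel_mul_complex hd hβ (g := seriesFibre β α ρ₀ k s)
      ((continuous_seriesFibre h k).measurable.comp (measurable_const.prodMk measurable_id))
      (fun w => norm_seriesFibre_le h k s w) v
  have h2 : Integrable fun u => (carlemanKernel β v u : ℂ) * (fun _ : 𝔼 => heatFibre β α b ρ₀ k s) (v + u) :=
    integrable_carlemanKernel_mul_complex hd hβ (g := fun _ => heatFibre β α b ρ₀ k s) measurable_const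
      (fun w => le_rfl) v
  have hfun : fibreDiff β α b ρ₀ k s = fun w => seriesFibre β α ρ₀ k s w - (fun _ : 𝔼 => heatFibre β α b ρ₀ k s) w := rfl
  rw [hfun, carlemanGainC_sub β (seriesFibre β α ρ₀ k s) (fun _ : 𝔼 => heatFibre β α b ρ₀ k s) h1 h2, carlemanGainC_const hd hβ]

/-- **The Duhamel identity for `D = ψ_k - ρ̂⁰(k) e^{-λt/α}`** (`t ≥ 0`):
`D(t, v) = α ∫₀ᵗ e^{-c(t-s)} (K D(s))(v) ds - ∫₀ᵗ e^{-c(t-s)} (iθ_k(v) - λ/α) ρ̂⁰(k) e^{-λs/α} ds`,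
`c = α a_β(v) + iθ_k(v)`. [cite: BodineauGallagherSaintRaymondInvent2016, §6.1.3] -/
theorem fibreDiff_eq (h : LinearBoltzmannData (Torus.geometry d) β α (fun x _ => ρ₀ x) ϱ)
    (hd : 2 ≤ Fintype.card d) (k : d → ℤ) {t : ℝ} (ht : 0 ≤ t) (v : 𝔼) :
    fibreDiff β α b ρ₀ k t v =
      (α : ℂ) * (∫ s in (0 : ℝ)..t, Complex.exp (-((α * collisionFrequency β v : ℝ) + fourierPhase k v * I) * (t - s)) *
          carlemanGainC β (fibreDiff β α b ρ₀ k s) v) -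
        ∫ s in (0 : ℝ)..t, Complex.exp (-((α * collisionFrequency β v : ℝ) + fourierPhase k v * I) * (t - s)) *
          ((fourierPhase k v * I - (heatRate β b k / α : ℝ)) * heatFibre β α b ρ₀ k s) := by
  have hβ := h.beta_pos
  set c : ℂ := ((α * collisionFrequency β v : ℝ) : ℂ) + fourierPhase k v * I with hc
  have hψ : seriesFibre β α ρ₀ k t v = Complex.exp (-c * t) * datumCoeff ρ₀ k +
      (α : ℂ) * ∫ s in (0 : ℝ)..t, Complex.exp (-c * (t - s)) * carlemanGainC β (seriesFibre β α ρ₀ k s) v := by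
    have h1 := kineticFibre_linearBoltzmannSeries_eq h hd k ht v
    rw [← hc] at h1
    exact h1
  have hheat : heatFibre β α b ρ₀ k t = Complex.exp (-c * t) * datumCoeff ρ₀ k +
      ∫ s in (0 : ℝ)..t, Complex.exp (-c * (t - s)) * ((c - (heatRate β b k / α : ℝ)) * heatFibre β α b ρ₀ k s) :=
    heatFactor_duhamel (datumCoeff ρ₀ k) c (heatRate β b k / α) t
  -- continuity of the integrands (for linearity of the interval integral)
  have hKc : Continuous fun s => carlemanGainC β (seriesFibre β α ρ₀ k s) v :=
    continuous_carlemanGainC_kineticFibre h hd k v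
  have hexpc : Continuous fun s : ℝ => Complex.exp (-c * (t - s)) := by fun_prop
  have hheatc : Continuous fun s : ℝ => heatFibre β α b ρ₀ k s := by unfold heatFibre; fun_prop
  have hI1 : IntervalIntegrable (fun s : ℝ => Complex.exp (-c * (t - s)) * carlemanGainC β (seriesFibre β α ρ₀ k s) v) volume 0 t :=
    (hexpc.mul hKc).intervalIntegrable 0 t
  have hI2 : IntervalIntegrable (fun s : ℝ => Complex.exp (-c * (t - s)) * ((collisionFrequency β v : ℂ) * heatFibre β α b ρ₀ k s))
      volume 0 t := (hexpc.mul (continuous_const.mul hheatc)).intervalIntegrable 0 t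
  have hI3 : IntervalIntegrable (fun s : ℝ => Complex.exp (-c * (t - s)) *
      ((fourierPhase k v * I - (heatRate β b k / α : ℝ)) * heatFibre β α b ρ₀ k s)) volume 0 t :=
    (hexpc.mul (continuous_const.mul hheatc)).intervalIntegrable 0 t
  -- `K D = K ψ - a · heat`
  have hKD : ∀ s : ℝ, Complex.exp (-c * (t - s)) * carlemanGainC β (fibreDiff β α b ρ₀ k s) v =
      Complex.exp (-c * (t - s)) * carlemanGainC β (seriesFibre β α ρ₀ k s) v -
        Complex.exp (-c * (t - s)) * ((collisionFrequency β v : ℂ) * heatFibre β α b ρ₀ k s) := fun s => by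
    rw [carlemanGainC_fibreDiff h hd k s v]; ring
  -- the heat factor identity, with `(c - μ) heat = α a heat + (iθ - μ) heat`
  have hsplit : ∀ s : ℝ, Complex.exp (-c * (t - s)) * ((c - (heatRate β b k / α : ℝ)) * heatFibre β α b ρ₀ k s) =
      (α : ℂ) * (Complex.exp (-c * (t - s)) * ((collisionFrequency β v : ℂ) * heatFibre β α b ρ₀ k s)) +
        Complex.exp (-c * (t - s)) * ((fourierPhase k v * I - (heatRate β b k / α : ℝ)) * heatFibre β α b ρ₀ k s) :=
    fun s => by rw [hc]; push_cast; ring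
  have hheat' : heatFibre β α b ρ₀ k t = Complex.exp (-c * t) * datumCoeff ρ₀ k +
      ((α : ℂ) * ∫ s in (0 : ℝ)..t, Complex.exp (-c * (t - s)) * ((collisionFrequency β v : ℂ) * heatFibre β α b ρ₀ k s)) +
      ∫ s in (0 : ℝ)..t, Complex.exp (-c * (t - s)) *
        ((fourierPhase k v * I - (heatRate β b k / α : ℝ)) * heatFibre β α b ρ₀ k s) := by
    rw [hheat]
    simp_rw [hsplit]
    rw [intervalIntegral.integral_add (hI2.const_mul _) hI3, intervalIntegral.integral_const_mul, add_assoc]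
  -- assemble
  rw [fibreDiff, hψ, hheat']
  simp_rw [hKD]
  rw [intervalIntegral.integral_sub hI1 hI2]
  ring

end Duhamel

/-! ## Bounds on the Duhamel integrals -/

section Bounds

/-- `‖e^{-c(t-s)}‖ = e^{-αa(t-s)}` for `c = αa + iθ`. [folklore] -/
theorem norm_exp_neg_mul_sub (αa θ t s : ℝ) :
    ‖Complex.exp (-((αa : ℂ) + θ * I) * (t - s))‖ = Real.exp (-(αa * (t - s))) := by
  rw [Complex.norm_exp]
  congr 1
  simp only [Complex.neg_re, Complex.mul_re, Complex.add_re, Complex.ofReal_re,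
    Complex.ofReal_im, Complex.I_re, Complex.I_im, Complex.sub_re, Complex.sub_im]
  ring

/-- `∫₀ᵗ e^{-κ(t-s)} ds = (1 - e^{-κt})/κ ≤ 1/κ` for `κ > 0`. [folklore] -/
theorem intervalIntegral_exp_neg_mul_sub_le {κ t : ℝ} (hκ : 0 < κ) :
    ∫ s in (0 : ℝ)..t, Real.exp (-(κ * (t - s))) ≤ κ⁻¹ := by
  have h := integral_mul_exp_neg_mul_sub κ t
  have h2 : ∫ s in (0 : ℝ)..t, Real.exp (-(κ * (t - s))) = κ⁻¹ * (1 - Real.exp (-(κ * t))) := by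
    rw [← h, ← intervalIntegral.integral_const_mul]
    refine intervalIntegral.integral_congr fun s _ => ?_
    rw [mul_comm (Real.exp _) κ, ← mul_assoc, inv_mul_cancel₀ hκ.ne', one_mul]
  rw [h2]
  have h3 : 0 < Real.exp (-(κ * t)) := Real.exp_pos _
  nlinarith [inv_pos.2 hκ]

/-- **Bound on a damped Duhamel integral**: if `‖f(s)‖ ≤ B` on `[0, t]` then
`‖∫₀ᵗ e^{-(αa+iθ)(t-s)} f(s) ds‖ ≤ B / (αa)` (`αa > 0`). [folklore] -/
theorem norm_intervalIntegral_exp_mul_le {αa θ t B : ℝ} (hαa : 0 < αa) (ht : 0 ≤ t) {f : ℝ → ℂ}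
    (hf : Continuous f) (hB : ∀ s ∈ Icc 0 t, ‖f s‖ ≤ B) :
    ‖∫ s in (0 : ℝ)..t, Complex.exp (-((αa : ℂ) + θ * I) * (t - s)) * f s‖ ≤ B * αa⁻¹ := by
  have hB0 : 0 ≤ B := (norm_nonneg _).trans (hB 0 ⟨le_rfl, ht⟩)
  calc ‖∫ s in (0 : ℝ)..t, Complex.exp (-((αa : ℂ) + θ * I) * (t - s)) * f s‖
      ≤ ∫ s in (0 : ℝ)..t, ‖Complex.exp (-((αa : ℂ) + θ * I) * (t - s)) * f s‖ :=
        intervalIntegral.norm_integral_le_integral_norm ht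
    _ ≤ ∫ s in (0 : ℝ)..t, Real.exp (-(αa * (t - s))) * B := by
        refine intervalIntegral.integral_mono_on ht ?_ ?_ fun s hs => ?_
        · exact ((by fun_prop : Continuous fun s : ℝ => Complex.exp (-((αa : ℂ) + θ * I) * (t - s)) * f s).norm).intervalIntegrable _ _
        · exact (by fun_prop : Continuous fun s : ℝ => Real.exp (-(αa * (t - s))) * B).intervalIntegrable _ _
        · rw [norm_mul, norm_exp_neg_mul_sub]
          exact mul_le_mul_of_nonneg_left (hB s hs) (Real.exp_nonneg _)
    _ = B * ∫ s in (0 : ℝ)..t, Real.exp (-(αa * (t - s))) := by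
        rw [← intervalIntegral.integral_const_mul]
        exact intervalIntegral.integral_congr fun s _ => by ring
    _ ≤ B * αa⁻¹ := mul_le_mul_of_nonneg_left (intervalIntegral_exp_neg_mul_sub_le hαa) hB0

end Bounds

/-! ## The gain operator from `L²(M_β)` to local bounds: near/far splitting -/

section NearFar

variable (hd : 2 ≤ Fintype.card d) (hβ : 0 < β)

/-- The supremum `M₀ = (2π/β)^{-d/2}` of the Maxwellian. [folklore] -/
def maxwellianSup (d : Type*) [Fintype d] (β : ℝ) : ℝ :=
  (2 * Real.pi * β⁻¹) ^ (-(Module.finrank ℝ (EuclideanSpace ℝ d) : ℝ) / 2)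

include hβ in
/-- `M_β ≤ M₀`. [folklore] -/
theorem maxwellianBeta_le_sup (v : 𝔼) : maxwellianBeta β v ≤ maxwellianSup d β := maxwellianBeta_le hβ v

include hβ in
/-- `M₀ > 0`. [folklore] -/
theorem maxwellianSup_pos : 0 < maxwellianSup d β := by
  unfold maxwellianSup; exact Real.rpow_pos_of_pos (by positivity) _

include hβ in
/-- **Lower bound of the Maxwellian on balls**: `M_β(v) ≥ M₀ e^{-βV²/2}` for `|v| ≤ V`. [folklore] -/
theorem maxwellianBeta_ge_of_norm_le {V : ℝ} {v : 𝔼} (hv : ‖v‖ ≤ V) :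
    maxwellianSup d β * Real.exp (-(β / 2) * V ^ 2) ≤ maxwellianBeta β v := by
  rw [maxwellianBeta_eq, maxwellianSup]
  refine mul_le_mul_of_nonneg_left ?_ (Real.rpow_pos_of_pos (by positivity) _).le
  rw [Real.exp_le_exp]
  have : ‖v‖ ^ 2 ≤ V ^ 2 := pow_le_pow_left₀ (norm_nonneg _) hv 2
  nlinarith

/-- Grad's bound read as a bound on the kernel: `k_β(v, u) ≤ G_β(u) √(M₀ / M_β(v))`. [folklore] -/
theorem carlemanKernel_le_gradRadial_mul (hβ : 0 < β) (v u : 𝔼) :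
    carlemanKernel β v u ≤ gradRadial β u * Real.sqrt (maxwellianSup d β / maxwellianBeta β v) := by
  have hM := maxwellianBeta_pos hβ v
  have hM' := maxwellianBeta_pos hβ (v + u)
  have h := maxwellianBeta_mul_carlemanKernel_le hβ v u
  rw [show (Real.sqrt (2 * Real.pi * β⁻¹))⁻¹ * (‖u‖ ^ (Fintype.card d - 2))⁻¹ * Real.exp (-(β / 8) * ‖u‖ ^ 2) =
    gradRadial β u from rfl] at h
  have h1 : carlemanKernel β v u ≤ gradRadial β u * (Real.sqrt (maxwellianBeta β v * maxwellianBeta β (v + u)) / maxwellianBeta β v) := by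
    rw [mul_div_assoc', le_div_iff₀ hM, mul_comm]; exact h
  refine h1.trans (mul_le_mul_of_nonneg_left ?_ (gradRadial_nonneg β u))
  rw [Real.le_sqrt (div_nonneg (Real.sqrt_nonneg _) hM.le) (div_nonneg (maxwellianSup_pos hβ).le hM.le), div_pow, Real.sq_sqrt (mul_nonneg hM.le hM'.le),
    div_le_div_iff₀ (pow_pos hM 2) hM]
  nlinarith [maxwellianBeta_le_sup hβ (v + u), hM]

/-- **The far majorant is integrable**: `1_{|u| ≥ δ} G_β(u)²` is dominated by `G_max(δ) G_β`. [folklore] -/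
theorem integrable_indicator_gradRadial_sq (hd : 2 ≤ Fintype.card d) (hβ : 0 < β) {δ : ℝ} (hδ : 0 < δ) :
    Integrable ((ball (0 : 𝔼) δ)ᶜ.indicator fun u => gradRadial β u ^ 2) := by
  set Gmax : ℝ := (Real.sqrt (2 * Real.pi * β⁻¹))⁻¹ * (δ ^ (Fintype.card d - 2))⁻¹ with hGmax
  have hGmax0 : 0 ≤ Gmax := by positivity
  refine ((integrable_gradRadial hd hβ).const_mul Gmax).mono' ?_ (Eventually.of_forall fun u => ?_)
  · exact ((measurable_gradRadial β).pow_const 2).indicator measurableSet_ball.compl |>.aestronglyMeasurable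
  · by_cases hu : u ∈ (ball (0 : 𝔼) δ)ᶜ
    · rw [indicator_of_mem hu, Real.norm_of_nonneg (sq_nonneg _), sq]
      refine mul_le_mul_of_nonneg_right ?_ (gradRadial_nonneg β u)
      have hnu : δ ≤ ‖u‖ := by simpa [mem_ball, dist_zero_right] using hu
      rw [gradRadial, hGmax]
      calc (Real.sqrt (2 * Real.pi * β⁻¹))⁻¹ * (‖u‖ ^ (Fintype.card d - 2))⁻¹ * Real.exp (-(β / 8) * ‖u‖ ^ 2)
          ≤ (Real.sqrt (2 * Real.pi * β⁻¹))⁻¹ * (‖u‖ ^ (Fintype.card d - 2))⁻¹ * 1 := by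
            gcongr
            rw [Real.exp_le_one_iff]; nlinarith [sq_nonneg ‖u‖, hβ]
        _ ≤ (Real.sqrt (2 * Real.pi * β⁻¹))⁻¹ * (δ ^ (Fintype.card d - 2))⁻¹ * 1 := by
            gcongr
        _ = _ := mul_one _
    · rw [indicator_of_notMem hu, norm_zero]
      exact mul_nonneg hGmax0 (gradRadial_nonneg β u)

/-- **The near/far bound on the gain operator.** For a measurable complex `g` with `‖g‖ ≤ R_g`,
`δ > 0` and `η > 0`,
`‖(K g)(v)‖ ≤ R_g √(M₀/M_β(v)) ∫_{|u|<δ} G_β + (∫_{|u|≥δ} G_β²) / (2η M_β(v)) + (η/2) ∫ |g|² M_β`: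
on `|u| < δ` Grad's bound `k_β ≤ G_β √(M₀/M_β(v))`, on `|u| ≥ δ` the elementary
`k |g| ≤ k²/(2η M_β(v+u)) + (η/2) M_β(v+u)|g|²` and `k_β² / M_β(v+u) ≤ G_β² / M_β(v)`.
[cite: CercignaniIllnerPulvirenti1994, §7.2] -/
theorem norm_carlemanGainC_le_nearFar (hd : 2 ≤ Fintype.card d) (hβ : 0 < β) {g : 𝔼 → ℂ}
    {Rg : ℝ} (hRg : ∀ w, ‖g w‖ ≤ Rg) (hg2 : Integrable fun w => ‖g w‖ ^ 2 * maxwellianBeta β w)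
    {δ η : ℝ} (hδ : 0 < δ) (hη : 0 < η) (v : 𝔼) :
    ‖carlemanGainC β g v‖ ≤
      Rg * Real.sqrt (maxwellianSup d β / maxwellianBeta β v) * (∫ u in ball (0 : 𝔼) δ, gradRadial β u) +
        (∫ u, (ball (0 : 𝔼) δ)ᶜ.indicator (fun u => gradRadial β u ^ 2) u) / (2 * η * maxwellianBeta β v) +
        η / 2 * ∫ w, ‖g w‖ ^ 2 * maxwellianBeta β w := by
  have hM := maxwellianBeta_pos hβ v
  have hRg0 : 0 ≤ Rg := (norm_nonneg _).trans (hRg 0)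
  set S := Real.sqrt (maxwellianSup d β / maxwellianBeta β v) with hS
  have hS0 : 0 ≤ S := Real.sqrt_nonneg _
  -- the majorant
  set maj : 𝔼 → ℝ := fun u => Rg * S * (ball (0 : 𝔼) δ).indicator (gradRadial β) u +
    ((ball (0 : 𝔼) δ)ᶜ.indicator (fun u => gradRadial β u ^ 2) u) / (2 * η * maxwellianBeta β v) +
    η / 2 * (‖g (v + u)‖ ^ 2 * maxwellianBeta β (v + u)) with hmaj
  have hpt : ∀ u, ‖(carlemanKernel β v u : ℂ) * g (v + u)‖ ≤ maj u := by
    intro u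
    have hk := carlemanKernel_nonneg β v u
    have hM' := maxwellianBeta_pos hβ (v + u)
    rw [norm_mul, Complex.norm_real, Real.norm_of_nonneg hk, hmaj]
    simp only
    by_cases hu : u ∈ ball (0 : 𝔼) δ
    · rw [indicator_of_mem hu, indicator_of_notMem (notMem_compl_iff.2 hu), zero_div, add_zero]
      have h1 : carlemanKernel β v u * ‖g (v + u)‖ ≤ gradRadial β u * S * Rg :=
        mul_le_mul (carlemanKernel_le_gradRadial_mul hβ v u) (hRg _) (norm_nonneg _) (mul_nonneg (gradRadial_nonneg β u) hS0)
      have h2 : 0 ≤ η / 2 * (‖g (v + u)‖ ^ 2 * maxwellianBeta β (v + u)) := by positivity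
      nlinarith
    · rw [indicator_of_notMem hu, indicator_of_mem (mem_compl hu), mul_zero, zero_add]
      -- `k |g| ≤ k² / (2η M') + (η/2) M' |g|²`
      have hyoung : carlemanKernel β v u * ‖g (v + u)‖ ≤
          carlemanKernel β v u ^ 2 / (2 * η * maxwellianBeta β (v + u)) + η / 2 * (‖g (v + u)‖ ^ 2 * maxwellianBeta β (v + u)) := by
        have h3 : 0 < 2 * η * maxwellianBeta β (v + u) := by positivity
        rw [div_add' _ _ _ h3.ne', le_div_iff₀ h3]
        nlinarith [sq_nonneg (carlemanKernel β v u - η * maxwellianBeta β (v + u) * ‖g (v + u)‖), hM'.le, hη.le,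
          mul_pos hη hM']
      have hfar : carlemanKernel β v u ^ 2 / (2 * η * maxwellianBeta β (v + u)) ≤
          gradRadial β u ^ 2 / (2 * η * maxwellianBeta β v) := by
        have h4 := carlemanKernel_sq_div_le hβ v u
        have e1 : carlemanKernel β v u ^ 2 / (2 * η * maxwellianBeta β (v + u)) =
            carlemanKernel β v u ^ 2 / maxwellianBeta β (v + u) / (2 * η) := by
          field_simp
        have e2 : gradRadial β u ^ 2 / (2 * η * maxwellianBeta β v) = gradRadial β u ^ 2 / maxwellianBeta β v / (2 * η) := by
          field_simp
        rw [e1, e2]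
        exact div_le_div_of_nonneg_right h4 (by positivity)
      linarith
  -- integrability of the majorant
  have hG := integrable_gradRadial hd hβ
  have hI1 : Integrable fun u => Rg * S * (ball (0 : 𝔼) δ).indicator (gradRadial β) u :=
    (hG.indicator measurableSet_ball).const_mul _
  have hI2 : Integrable fun u => ((ball (0 : 𝔼) δ)ᶜ.indicator (fun u => gradRadial β u ^ 2) u) / (2 * η * maxwellianBeta β v) :=
    (integrable_indicator_gradRadial_sq hd hβ hδ).div_const _
  have hI3 : Integrable fun u => η / 2 * (‖g (v + u)‖ ^ 2 * maxwellianBeta β (v + u)) :=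
    (hg2.comp_add_left v).const_mul _
  have hI12 : Integrable fun u => Rg * S * (ball (0 : 𝔼) δ).indicator (gradRadial β) u +
      ((ball (0 : 𝔼) δ)ᶜ.indicator (fun u => gradRadial β u ^ 2) u) / (2 * η * maxwellianBeta β v) := hI1.add hI2
  have hImaj : Integrable maj := hI12.add hI3
  calc ‖carlemanGainC β g v‖ ≤ ∫ u, ‖(carlemanKernel β v u : ℂ) * g (v + u)‖ := norm_integral_le_integral_norm _
    _ ≤ ∫ u, maj u := integral_mono_of_nonneg (Eventually.of_forall fun u => norm_nonneg _) hImaj (Eventually.of_forall hpt)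
    _ = Rg * S * (∫ u in ball (0 : 𝔼) δ, gradRadial β u) +
          (∫ u, (ball (0 : 𝔼) δ)ᶜ.indicator (fun u => gradRadial β u ^ 2) u) / (2 * η * maxwellianBeta β v) +
          η / 2 * ∫ w, ‖g w‖ ^ 2 * maxwellianBeta β w := by
        rw [hmaj, integral_add hI12 hI3, integral_add hI1 hI2, integral_const_mul, integral_const_mul, integral_div,
          integral_indicator measurableSet_ball,
          integral_add_left_eq_self (fun w => ‖g w‖ ^ 2 * maxwellianBeta β w) v]

end NearFar

/-! ## Locally uniform relaxation of the fibres -/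

section Relaxation

open Literature.Analysis.FluidPDE Literature.Analysis.FunctionSpaces

variable {b : EuclideanSpace ℝ d → EuclideanSpace ℝ d} {ρ₀ : UnitAddTorus d → ℝ} {ϱ : ℝ} {k : d → ℤ}

/-- `|heat(t)| ≤ |ρ̂⁰(k)|` for `t ≥ 0`. [folklore] -/
theorem norm_heatFibre_le (hd : 2 ≤ Fintype.card d) (hβ : 0 < β) (hb : IsDiffusionCorrector β b) (hα : 0 < α)
    (k : d → ℤ) {t : ℝ} (ht : 0 ≤ t) : ‖heatFibre β α b ρ₀ k t‖ ≤ ‖datumCoeff ρ₀ k‖ := by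
  rw [heatFibre, norm_mul, Complex.norm_real, Real.norm_of_nonneg (Real.exp_nonneg _)]
  calc ‖datumCoeff ρ₀ k‖ * Real.exp (-(heatRate β b k / α * t)) ≤ ‖datumCoeff ρ₀ k‖ * 1 := by
        gcongr; exact exp_heatRate_le_one (div_nonneg (heatRate_nonneg hd hβ hb k) hα.le) ht
    _ = _ := mul_one _

/-- `|D(t, v)| ≤ ϱ + |ρ̂⁰(k)|` for `t ≥ 0`. [folklore] -/
theorem norm_fibreDiff_le (h : LinearBoltzmannData (Torus.geometry d) β α (fun x _ => ρ₀ x) ϱ)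
    (hd : 2 ≤ Fintype.card d) (hb : IsDiffusionCorrector β b) (hα : 0 < α) (k : d → ℤ) {t : ℝ} (ht : 0 ≤ t) (v : 𝔼) :
    ‖fibreDiff β α b ρ₀ k t v‖ ≤ ϱ + ‖datumCoeff ρ₀ k‖ :=
  (norm_sub_le _ _).trans (add_le_add (norm_seriesFibre_le h k t v) (norm_heatFibre_le hd h.beta_pos hb hα k ht))

/-- `s ↦ (K D(s))(v)` is continuous. [folklore] -/
theorem continuous_carlemanGainC_fibreDiff (h : LinearBoltzmannData (Torus.geometry d) β α (fun x _ => ρ₀ x) ϱ)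
    (hd : 2 ≤ Fintype.card d) (k : d → ℤ) (v : 𝔼) :
    Continuous fun s => carlemanGainC β (fibreDiff β α b ρ₀ k s) v := by
  simp_rw [carlemanGainC_fibreDiff h hd k _ v]
  refine (continuous_carlemanGainC_kineticFibre h hd k v).sub (continuous_const.mul ?_)
  unfold heatFibre; fun_prop

/-- `√α / α = 1/√α`. [folklore] -/
theorem sqrt_div_self_eq_inv {α : ℝ} (hα : 0 < α) : Real.sqrt α / α = (Real.sqrt α)⁻¹ := by
  have hs : 0 < Real.sqrt α := Real.sqrt_pos.2 hα
  field_simp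
  rw [Real.sq_sqrt hα.le]

set_option maxHeartbeats 800000 in
/-- **Locally uniform relaxation of the Fourier fibres** (BGSR (6.3), mode by mode, before the
`M_β`-weighting): for `d ≥ 2`, `β > 0`, a corrector `b`, a continuous datum `0 ≤ ρ⁰ ≤ R`, a mode
`k`, `T ≥ 0`, a velocity radius `V` and `ε > 0` there is `α₀ ≥ 1` such that for `α ≥ α₀`,
`t ∈ [0, αT]` and `|v| ≤ V`,
`|ψ_k(t, v) - ρ̂⁰(k) e^{-4π² κ_β |k|² t/α}| ≤ ε`, `ψ_k` the `k`-th Fourier coefficient of the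
collision-series solution of (1.3) with rate `α`.
[cite: BodineauGallagherSaintRaymondInvent2016, (6.3) and §6.1.3] -/
theorem norm_fibreDiff_le_of_large (hd : 2 ≤ Fintype.card d) (hβ : 0 < β) (hb : IsDiffusionCorrector β b) {R : ℝ}
    (hρc : Continuous ρ₀) (hρ0 : ∀ x, 0 ≤ ρ₀ x) (hρR : ∀ x, ρ₀ x ≤ R) (k : d → ℤ) {T : ℝ} (hT : 0 ≤ T) (V : ℝ)
    {ε : ℝ} (hε : 0 < ε) :
    ∃ α₀ : ℝ, 1 ≤ α₀ ∧ ∀ α : ℝ, α₀ ≤ α → ∀ t ∈ Icc 0 (α * T), ∀ v : 𝔼, ‖v‖ ≤ V →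
      ‖fibreDiff β α b ρ₀ k t v‖ ≤ ε := by
  haveI : Nonempty d := Fintype.card_pos_iff.1 (by omega)
  obtain ⟨a₀, ha₀, c, hc, hlow⟩ := exists_collisionFrequency_lowerBound (d := d) hd hβ
  have hapos : ∀ v : 𝔼, 0 < collisionFrequency β v := fun v => ha₀.trans_le (hlow v).1
  obtain ⟨CE, hCE0, hE⟩ := kineticFibre_energy_estimate hd hβ hb ρ₀ k hT
  set g := ‖datumCoeff ρ₀ k‖ with hg
  have hg0 : 0 ≤ g := norm_nonneg _
  have hR0 : 0 ≤ R := (hρ0 0).trans (hρR 0)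
  set Rg := R + g with hRg
  have hRg0 : 0 ≤ Rg := by positivity
  set M₀ := maxwellianSup d β with hM₀
  have hM₀0 : 0 < M₀ := maxwellianSup_pos hβ
  set MV := M₀ * Real.exp (-(β / 2) * V ^ 2) with hMV
  have hMV0 : 0 < MV := by positivity
  set S := Real.sqrt (M₀ / MV) with hS
  have hS0 : 0 ≤ S := Real.sqrt_nonneg _
  set lam := heatRate β b k with hlam
  have hlam0 : 0 ≤ lam := heatRate_nonneg hd hβ hb k
  set θV := 2 * π * ‖kVec k‖ * |V| with hθV
  have hθV0 : 0 ≤ θV := by positivity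
  -- the near part: choose `δ = (n+1)⁻¹`
  set νs := ε * a₀ / (4 * (Rg * S + 1)) with hνs
  have hνs0 : 0 < νs := by positivity
  obtain ⟨n, hn⟩ := ((tendsto_setIntegral_gradRadial hd hβ).eventually (gt_mem_nhds hνs0)).exists
  set δ : ℝ := ((n : ℝ) + 1)⁻¹ with hδ
  have hδ0 : 0 < δ := by positivity
  set ν := ∫ u in ball (0 : 𝔼) δ, gradRadial β u with hν
  have hν0 : 0 ≤ ν := setIntegral_nonneg measurableSet_ball fun u _ => gradRadial_nonneg β u
  have hνle : ν < νs := hn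
  set F := ∫ u, (ball (0 : 𝔼) δ)ᶜ.indicator (fun u => gradRadial β u ^ 2) u with hF
  have hF0 : 0 ≤ F := integral_nonneg fun u => indicator_nonneg (fun u _ => sq_nonneg _) u
  -- the constants and `α₀`
  set K₁ := F / (2 * MV) + CE / 2 with hK₁
  have hK₁0 : 0 ≤ K₁ := by positivity
  set K₂ := (θV + lam) * g with hK₂
  have hK₂0 : 0 ≤ K₂ := by positivity
  refine ⟨max 1 (max ((4 * K₁ / (a₀ * ε)) ^ 2 + 1) (4 * K₂ / (a₀ * ε) + 1)), le_max_left _ _, fun α hα t ht v hv => ?_⟩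
  have hα1 : 1 ≤ α := le_trans (le_max_left _ _) hα
  have hα0 : 0 < α := lt_of_lt_of_le one_pos hα1
  have hαK₁ : (4 * K₁ / (a₀ * ε)) ^ 2 ≤ α :=
    le_trans (by linarith only) (le_trans (le_max_left _ _) (le_trans (le_max_right _ _) hα))
  have hαK₂ : 4 * K₂ / (a₀ * ε) ≤ α :=
    le_trans (by linarith only) (le_trans (le_max_right _ _) (le_trans (le_max_right _ _) hα))
  have hsα : 0 < Real.sqrt α := Real.sqrt_pos.2 hα0
  have hsα' : 4 * K₁ / (a₀ * ε) ≤ Real.sqrt α := by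
    rw [← Real.sqrt_sq (by positivity : 0 ≤ 4 * K₁ / (a₀ * ε))]; exact Real.sqrt_le_sqrt hαK₁
  have h := linearBoltzmannData_torus hβ hα0.le hρc hρ0 hρR
  have ht0 : 0 ≤ t := ht.1
  have hMv : MV ≤ maxwellianBeta β v := maxwellianBeta_ge_of_norm_le hβ hv
  have hMvpos := maxwellianBeta_pos hβ v
  -- Step 1: the bound on `(K D(s))(v)` for `s ∈ [0, t]`
  set B := Rg * S * ν + F / (2 * Real.sqrt α * MV) + Real.sqrt α / 2 * (CE / α) with hB
  have hKD : ∀ s ∈ Icc 0 t, ‖carlemanGainC β (fibreDiff β α b ρ₀ k s) v‖ ≤ B := by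
    intro s hs
    have hs0 : 0 ≤ s := hs.1
    have hsT : s ∈ Icc 0 (α * T) := ⟨hs0, hs.2.trans ht.2⟩
    have hDm : Measurable (fibreDiff β α b ρ₀ k s) :=
      ((continuous_seriesFibre h k).measurable.comp (measurable_const.prodMk measurable_id)).sub measurable_const
    have hDb : ∀ w, ‖fibreDiff β α b ρ₀ k s w‖ ≤ Rg := fun w => norm_fibreDiff_le h hd hb hα0 k hs0 w
    have hD2 : Integrable fun w => ‖fibreDiff β α b ρ₀ k s w‖ ^ 2 * maxwellianBeta β w := by
      refine ((KineticTheory.integrable_maxwellianBeta hβ).const_mul (Rg ^ 2)).mono'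
        ((hDm.norm.pow_const 2).mul (KineticTheory.measurable_maxwellianBeta β)).aestronglyMeasurable
        (Eventually.of_forall fun w => ?_)
      have hM := (maxwellianBeta_pos hβ w).le
      rw [Real.norm_of_nonneg (mul_nonneg (sq_nonneg _) hM)]
      exact mul_le_mul_of_nonneg_right (pow_le_pow_left₀ (norm_nonneg _) (hDb w) 2) hM
    have hnf := norm_carlemanGainC_le_nearFar hd hβ hDb hD2 hδ0 hsα v
    have henergy := hE hα1 h s hsT
    -- compare the three terms with `B`
    have h1 : Rg * Real.sqrt (M₀ / maxwellianBeta β v) * ν ≤ Rg * S * ν := by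
      gcongr
      exact Real.sqrt_le_sqrt (div_le_div_of_nonneg_left hM₀0.le hMV0 hMv)
    have h2 : F / (2 * Real.sqrt α * maxwellianBeta β v) ≤ F / (2 * Real.sqrt α * MV) := by
      gcongr
    have h3 : Real.sqrt α / 2 * ∫ w, ‖fibreDiff β α b ρ₀ k s w‖ ^ 2 * maxwellianBeta β w ≤ Real.sqrt α / 2 * (CE / α) := by
      gcongr
      exact henergy
    calc ‖carlemanGainC β (fibreDiff β α b ρ₀ k s) v‖ ≤ _ := hnf
      _ ≤ B := by rw [hB]; exact add_le_add (add_le_add h1 h2) h3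
  -- Step 2: the Duhamel identity and the two terms
  have hB0 : 0 ≤ B := by positivity
  rw [fibreDiff_eq h hd k ht0 v]
  have hterm1 : ‖(α : ℂ) * ∫ s in (0 : ℝ)..t, Complex.exp (-((α * collisionFrequency β v : ℝ) + fourierPhase k v * I) * (t - s)) *
      carlemanGainC β (fibreDiff β α b ρ₀ k s) v‖ ≤ B * a₀⁻¹ := by
    rw [norm_mul, Complex.norm_real, Real.norm_of_nonneg hα0.le]
    have h1 := norm_intervalIntegral_exp_mul_le (θ := fourierPhase k v) (mul_pos hα0 (hapos v)) ht0
      (continuous_carlemanGainC_fibreDiff h hd k v) hKD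
    calc α * ‖∫ s in (0 : ℝ)..t, Complex.exp (-((α * collisionFrequency β v : ℝ) + fourierPhase k v * I) * (t - s)) *
          carlemanGainC β (fibreDiff β α b ρ₀ k s) v‖ ≤ α * (B * (α * collisionFrequency β v)⁻¹) :=
          mul_le_mul_of_nonneg_left h1 hα0.le
      _ = B * (collisionFrequency β v)⁻¹ := by field_simp
      _ ≤ B * a₀⁻¹ := by gcongr; exact (hlow v).1
  have hterm2 : ‖∫ s in (0 : ℝ)..t, Complex.exp (-((α * collisionFrequency β v : ℝ) + fourierPhase k v * I) * (t - s)) *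
      ((fourierPhase k v * I - (heatRate β b k / α : ℝ)) * heatFibre β α b ρ₀ k s)‖ ≤ K₂ * (α * a₀)⁻¹ := by
    have hf : Continuous fun s : ℝ => (fourierPhase k v * I - (heatRate β b k / α : ℝ)) * heatFibre β α b ρ₀ k s := by
      unfold heatFibre; fun_prop
    have hfb : ∀ s ∈ Icc 0 t, ‖(fourierPhase k v * I - (heatRate β b k / α : ℝ)) * heatFibre β α b ρ₀ k s‖ ≤ K₂ := by
      intro s hs
      rw [norm_mul]
      refine mul_le_mul ?_ (norm_heatFibre_le hd hβ hb hα0 k hs.1) (norm_nonneg _) (by positivity)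
      calc ‖(fourierPhase k v : ℂ) * I - ((heatRate β b k / α : ℝ) : ℂ)‖
          ≤ ‖(fourierPhase k v : ℂ) * I‖ + ‖((heatRate β b k / α : ℝ) : ℂ)‖ := norm_sub_le _ _
        _ = |fourierPhase k v| + lam / α := by
            rw [norm_mul, Complex.norm_I, mul_one, Complex.norm_real, Complex.norm_real, Real.norm_eq_abs, Real.norm_eq_abs,
              abs_of_nonneg (div_nonneg hlam0 hα0.le)]
        _ ≤ θV + lam := by
            refine add_le_add ((abs_fourierPhase_le k v).trans ?_) ?_
            · rw [hθV]; gcongr; exact hv.trans (le_abs_self V)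
            · exact div_le_self hlam0 hα1
    have h1 := norm_intervalIntegral_exp_mul_le (θ := fourierPhase k v) (mul_pos hα0 (hapos v)) ht0 hf hfb
    calc _ ≤ K₂ * (α * collisionFrequency β v)⁻¹ := h1
      _ ≤ K₂ * (α * a₀)⁻¹ := by gcongr; exact (hlow v).1
  -- Step 3: bookkeeping
  have hB' : B * a₀⁻¹ ≤ ε / 4 + ε / 4 := by
    have h1 : Rg * S * ν ≤ (Rg * S + 1) * νs :=
      calc Rg * S * ν ≤ Rg * S * νs := mul_le_mul_of_nonneg_left hνle.le (mul_nonneg hRg0 hS0)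
        _ ≤ (Rg * S + 1) * νs := mul_le_mul_of_nonneg_right (by linarith only [mul_nonneg hRg0 hS0]) hνs0.le
    have h2 : (Rg * S + 1) * νs * a₀⁻¹ = ε / 4 := by rw [hνs]; field_simp
    have h3 : F / (2 * Real.sqrt α * MV) + Real.sqrt α / 2 * (CE / α) = K₁ * (Real.sqrt α)⁻¹ := by
      rw [hK₁, show Real.sqrt α / 2 * (CE / α) = CE / 2 * (Real.sqrt α / α) by ring, sqrt_div_self_eq_inv hα0]
      field_simp
    have h4 : K₁ * (Real.sqrt α)⁻¹ * a₀⁻¹ ≤ ε / 4 := by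
      rw [← div_eq_mul_inv, ← div_eq_mul_inv, div_div, div_le_iff₀ (by positivity)]
      have h5 : 4 * K₁ ≤ Real.sqrt α * (a₀ * ε) := by
        have := mul_le_mul_of_nonneg_right hsα' (by positivity : 0 ≤ a₀ * ε)
        rwa [div_mul_cancel₀ _ (by positivity : a₀ * ε ≠ 0)] at this
      linarith only [h5]
    calc B * a₀⁻¹ = Rg * S * ν * a₀⁻¹ + (F / (2 * Real.sqrt α * MV) + Real.sqrt α / 2 * (CE / α)) * a₀⁻¹ := by
          rw [hB]; ring
      _ ≤ (Rg * S + 1) * νs * a₀⁻¹ + K₁ * (Real.sqrt α)⁻¹ * a₀⁻¹ := by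
          rw [h3]; gcongr
      _ ≤ ε / 4 + ε / 4 := by rw [h2]; linarith only [h4]
  have hK₂' : K₂ * (α * a₀)⁻¹ ≤ ε / 4 := by
    rw [← div_eq_mul_inv, div_le_iff₀ (by positivity)]
    have h5 : 4 * K₂ ≤ α * (a₀ * ε) := by
      have := mul_le_mul_of_nonneg_right hαK₂ (by positivity : 0 ≤ a₀ * ε)
      rwa [div_mul_cancel₀ _ (by positivity : a₀ * ε ≠ 0)] at this
    linarith only [h5]
  calc _ ≤ ‖(α : ℂ) * ∫ s in (0 : ℝ)..t, Complex.exp (-((α * collisionFrequency β v : ℝ) + fourierPhase k v * I) * (t - s)) *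
        carlemanGainC β (fibreDiff β α b ρ₀ k s) v‖ +
        ‖∫ s in (0 : ℝ)..t, Complex.exp (-((α * collisionFrequency β v : ℝ) + fourierPhase k v * I) * (t - s)) *
          ((fourierPhase k v * I - (heatRate β b k / α : ℝ)) * heatFibre β α b ρ₀ k s)‖ := norm_sub_le _ _
    _ ≤ B * a₀⁻¹ + K₂ * (α * a₀)⁻¹ := add_le_add hterm1 hterm2
    _ ≤ ε / 4 + ε / 4 + ε / 4 := add_le_add hB' hK₂'
    _ ≤ ε := by linarith only [hε]

end Relaxation

end Literature.MathematicalPhysics.KineticTheory
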